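import Mathlib
import HarnessLib
import HarnessLib.Audit
import Summits.AnomalousDissipation.Statement
import Summits.AnomalousDissipation.AnomalousDissipation.Theses.DebrisQuanta

/-!
# Record of the dropped route item `DebrisQuanta.RobustDecayQuantum` (stmt-AnomalousDissipation-2859)

Route `AnomalousDissipation/DebrisQuanta` dropped its item `RobustDecayQuantum`
(stmt-AnomalousDissipation-2859) on 2026-08-15T16:21:43Z after it was closed `refuted` by
`Summit.AnomalousDissipation.AnomalousDissipation.Theorems.DebrisQuantaRobustDecayQuantum_refuted`
(`Theorems/DebrisQuantaRobustDecayQuantumRefutation.lean`). The gate-written route file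
`Theses/DebrisQuanta.lean` therefore no longer declares the constant, while the refutation — a
Theorems file, append-only, whose statement text `¬ …Theses.DebrisQuanta.RobustDecayQuantum` may not
change — still names it, so that module stopped building ("Unknown identifier", full builds of
2026-08-16). This module re-declares the constant under its ORIGINAL fully-qualified name with its
ORIGINAL definiens (the item's ledger signature, verbatim), in the route file's namespace and `open`
context, so that the refutation record elaborates again; it is imported by that file only. It is NOT
a route item (no `route_item` attribute) and it is FALSE (see the refutation). It lives in its own
module because the refutation file is at the 400-line cap of Theorems files.
-/

namespace Summit.AnomalousDissipation.AnomalousDissipation.Theses.DebrisQuanta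

open scoped BigOperators Topology Manifold Classical MeasureTheory ProbabilityTheory Matrix InnerProductSpace ComplexConjugate ContinuousMap
open Filter Set Function TopologicalSpace MeasureTheory
open Literature.Turb

/-- **Record of the dropped route item `RobustDecayQuantum`** = stmt-AnomalousDissipation-2859
(ledger signature verbatim; NOT a route item; FALSE —
`Theorems.DebrisQuantaRobustDecayQuantum_refuted`): eventual uniform viscous burn `≥ q > 0` on
`[t_j, t_j + 1]` for vanishing-viscosity Leray–Hopf families whose slice at a debris time `t_j ≥ 0`
is `L²`-close to a background plus the collapse debris profile `D_{α,W}(· − a_j)`; refuted because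
the `t = 0` slice of the Leray–Hopf class is unconstrained junk. Re-declared only so that the
refutation record keeps elaborating (see the module docstring). -/
def RobustDecayQuantum : Prop :=
  let D : ℝ → (EuclideanSpace ℝ (Fin 3) → EuclideanSpace ℝ (Fin 3)) → UnitAddTorus (Fin 3) → EuclideanSpace ℝ (Fin 3) := fun α W x => Literature.Analysis.FluidPDE.curl (fun z : EuclideanSpace ℝ (Fin 3) => (Real.smoothTransition (2 - 8 * ‖z‖) * ‖z‖ ^ (1 - α)) • W (‖z‖⁻¹ • z)) (Literature.Analysis.FunctionSpaces.Torus.repr x - (!₂[(1:ℝ)/2, 1/2, 1/2] : EuclideanSpace ℝ (Fin 3))); let Adm : ℝ → (EuclideanSpace ℝ (Fin 3) → EuclideanSpace ℝ (Fin 3)) → Prop := fun α W => ContDiff ℝ ((⊤ : ℕ∞) : WithTop ℕ∞) W ∧ ∃ y : EuclideanSpace ℝ (Fin 3), y ≠ 0 ∧ Literature.Analysis.FluidPDE.curl (fun z : EuclideanSpace ℝ (Fin 3) => (‖z‖ ^ (1 - α)) • W (‖z‖⁻¹ • z)) y ≠ 0; let Bg : ℝ → (UnitAddTorus (Fin 3)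 → EuclideanSpace ℝ (Fin 3)) → Prop := fun M b => Literature.Analysis.FunctionSpaces.Torus.IsSmooth b ∧ Literature.Analysis.FunctionSpaces.Torus.IsDivFree b ∧ ∀ y : EuclideanSpace ℝ (Fin 3), ‖Literature.Analysis.FunctionSpaces.Torus.lift b y‖ ≤ M ∧ ‖fderiv ℝ (Literature.Analysis.FunctionSpaces.Torus.lift b) y‖ ≤ M; let Good : ℝ → (UnitAddTorus (Fin 3) → EuclideanSpace ℝ (Fin 3)) → (ℝ → UnitAddTorus (Fin 3) → EuclideanSpace ℝ (Fin 3)) → ℝ → Prop := fun ν f u t₀ => ∀ t : ℝ, t₀ ≤ t → Literature.Analysis.FunctionSpaces.Torus.kineticEnergy (u t) + ν * (∫⁻ s in Set.Ioo t₀ t, Literature.Analysis.FunctionSpaces.Torus.eGradNormSq (u s)).toReal ≤ Literature.Analysis.FunctionSpaces.Torus.kineticEnergy (u t₀) + ∫ s in t₀..t, ∫ x, inner ℝ (f x) (u s x); let burn : ℝ → (ℝ → UnitAddTorus (Fin 3) → EuclideanSpace ℝ (Fin 3)) → ℝ → ℝ → ℝ := fun ν u a b => ν * (∫⁻ s in Set.Ioo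 a b, Literature.Analysis.FunctionSpaces.Torus.eGradNormSq (u s)).toReal; ∀ (α : ℝ) (W : EuclideanSpace ℝ (Fin 3) → EuclideanSpace ℝ (Fin 3)) (f : UnitAddTorus (Fin 3) → EuclideanSpace ℝ (Fin 3)) (M c : ℝ), 2/3 < α → α < 1 → Adm α W → Literature.Analysis.FunctionSpaces.Torus.IsSmooth f → ∃ q : ℝ, 0 < q ∧ ∀ (ν t : ℕ → ℝ) (a : ℕ → UnitAddTorus (Fin 3)) (b : ℕ → UnitAddTorus (Fin 3) → EuclideanSpace ℝ (Fin 3)) (u₀ : ℕ → UnitAddTorus (Fin 3) → EuclideanSpace ℝ (Fin 3)) (u : ℕ → ℝ → UnitAddTorus (Fin 3) → EuclideanSpace ℝ (Fin 3)), (∀ j, 0 < ν j) → Filter.Tendsto ν Filter.atTop (nhds 0) → (∀ j, Literature.Analysis.FluidPDE.Torus.IsGlobalLerayHopf (ν j) (fun _ => f) (u₀ j) (u j)) → (∀ j, 0 ≤ t j ∧ Good (ν j) f (u j) (t j)) → (∀ j, Bg M (b j)) → (∀ j, MeasureTheory.eLpNorm (fun x => u j (t j) x - b j x - D α W (x - a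 j)) 2 MeasureTheory.volume ≤ ENNReal.ofReal (c * (ν j) ^ ((3 - 2 * α) / (2 * (1 - α))))) → ∀ᶠ j in Filter.atTop, q ≤ burn (ν j) (u j) (t j) (t j + 1)

end Summit.AnomalousDissipation.AnomalousDissipation.Theses.DebrisQuanta
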